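import Literature.Probability.LatticeModels.HighDimTrivialityWick
import Summits.CriticalPhenomena.Ising3DConformalLimit.Theses.HyperoctahedralRP
import HarnessLib

/-!
# Stub 6a `stub_crossPairingBound` of line `Sketch` (crux stmt-CriticalPhenomena-1344 `MoebiusLimitExists`)
= the combinatorial heart of item stmt-1982's `stub_clustering` (line `free-endpoint-gaussian-closure`)

MODEL-FREE PARITY LEMMA WITH A PRICE for the Gaussian pairing functional
`pairingSum f k z = (2ᵏ k!)⁻¹ Σ_{τ ∈ Perm (Fin 2k)} ∏_{j<k} f (z (τ (2j))) (z (τ (2j+1)))`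
(`Literature.Probability.LatticeModels.pairingSum`, `pairIdx k (j, b) = 2j + b`): if an index block `A` of ODD size
is given, every ordering has a pair meeting both `A` and `Aᶜ` (the pairs of an ordering partition `Fin (2k)`, a
union of pairs is even), so pair values in `[0, M]` with cross values `≤ ε` give `pairingSum f k z ≤ (2k)! M^(k-1) ε`.
-/

noncomputable section

open Filter Topology
open Literature.Probability.LatticeModels
open EuclideanGeometry

namespace Summit.CriticalPhenomena.Ising3DConformalLimit.Cruxes.InversionUpgradeNormalised.FreeEndpointGaussianClosure

/-- **Parity lemma with a price.** For `f` with all pair values on `z` in `[0, M]` and all CROSS values (one index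
in the odd block `A`, one outside) at most `ε`: `pairingSum f k z ≤ (2k)! · M^(k-1) · ε`. Every ordering `τ` has a
cross pair `{τ(2j), τ(2j+1)}` (else `A` would be a union of pairs, of even size), whose factor is `≤ ε`, the other
`k - 1` factors being `≤ M`; sum over the `(2k)!` orderings and use `(2ᵏ k!)⁻¹ ≤ 1`. [folklore] -/
theorem stub_crossPairingBound :
    ∀ (f : EuclideanSpace ℝ (Fin 3) → EuclideanSpace ℝ (Fin 3) → ℝ) (k : ℕ)
      (z : Fin (2 * k) → EuclideanSpace ℝ (Fin 3)) (A : Finset (Fin (2 * k))) (M ε : ℝ),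
      Odd A.card → 0 ≤ M → 0 ≤ ε →
      (∀ i j, i ≠ j → 0 ≤ f (z i) (z j) ∧ f (z i) (z j) ≤ M) →
      (∀ i j, i ∈ A → j ∉ A → f (z i) (z j) ≤ ε ∧ f (z j) (z i) ≤ ε) →
      pairingSum f k z ≤ (Nat.factorial (2 * k) : ℝ) * M ^ (k - 1) * ε := by
  intro f k z A M ε hA _ hε hf hcross
  classical
  -- the two indices of a pair of an ordering are distinct
  have hne : ∀ (τ : Equiv.Perm (Fin (2 * k))) (j : Fin k),
      τ (pairIdx k (j, 0)) ≠ τ (pairIdx k (j, 1)) := by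
    intro τ j h
    have h' := (pairIdx k).injective (τ.injective h)
    simp at h'
  -- PARITY: every ordering has a cross pair (one index in `A`, the other outside)
  have parity : ∀ τ : Equiv.Perm (Fin (2 * k)), ∃ j : Fin k,
      (τ (pairIdx k (j, 0)) ∈ A ∧ τ (pairIdx k (j, 1)) ∉ A) ∨
        (τ (pairIdx k (j, 1)) ∈ A ∧ τ (pairIdx k (j, 0)) ∉ A) := by
    intro τ
    by_contra h
    have hiff : ∀ j : Fin k, (τ (pairIdx k (j, 1)) ∈ A ↔ τ (pairIdx k (j, 0)) ∈ A) :=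
      fun j => ⟨fun h1 => by_contra fun h0 => h ⟨j, Or.inr ⟨h1, h0⟩⟩,
        fun h0 => by_contra fun h1 => h ⟨j, Or.inl ⟨h0, h1⟩⟩⟩
    -- count `A` along the pairs of `τ`
    have hcard : A.card = ∑ j : Fin k, ((if τ (pairIdx k (j, 0)) ∈ A then 1 else 0 : ℕ) +
        (if τ (pairIdx k (j, 1)) ∈ A then 1 else 0 : ℕ)) := by
      rw [Finset.card_eq_sum_ite (Finset.subset_univ A),
        ← Fintype.sum_equiv ((pairIdx k).trans τ)
          (fun p : Fin k × Fin 2 => (if τ (pairIdx k p) ∈ A then 1 else 0 : ℕ))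
          (fun i => if i ∈ A then 1 else 0) (fun _ => rfl),
        Fintype.sum_prod_type]
      simp only [Fin.sum_univ_two]
    have h2 : A.card = 2 * ∑ j : Fin k, (if τ (pairIdx k (j, 0)) ∈ A then 1 else 0 : ℕ) := by
      rw [hcard, Finset.mul_sum]
      refine Finset.sum_congr rfl fun j _ => ?_
      simp only [hiff j, two_mul]
    exact (Nat.not_even_iff_odd.mpr hA) ⟨_, h2.trans (two_mul _)⟩
  -- PRICE: the summand of every ordering is at most `M ^ (k - 1) * ε`
  have hprod : ∀ τ : Equiv.Perm (Fin (2 * k)),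
      ∏ j : Fin k, f (z (τ (pairIdx k (j, 0)))) (z (τ (pairIdx k (j, 1)))) ≤
        M ^ (k - 1) * ε := by
    intro τ
    obtain ⟨j, hj⟩ := parity τ
    have hj' : f (z (τ (pairIdx k (j, 0)))) (z (τ (pairIdx k (j, 1)))) ≤ ε := by
      rcases hj with ⟨h0, h1⟩ | ⟨h1, h0⟩
      · exact (hcross _ _ h0 h1).1
      · exact (hcross _ _ h1 h0).2
    rw [← Finset.mul_prod_erase Finset.univ _ (Finset.mem_univ j)]
    calc f (z (τ (pairIdx k (j, 0)))) (z (τ (pairIdx k (j, 1)))) *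
          ∏ i ∈ Finset.univ.erase j, f (z (τ (pairIdx k (i, 0)))) (z (τ (pairIdx k (i, 1))))
        ≤ ε * ∏ _i ∈ Finset.univ.erase j, M :=
          mul_le_mul hj' (Finset.prod_le_prod (fun i _ => (hf _ _ (hne τ i)).1)
            (fun i _ => (hf _ _ (hne τ i)).2))
            (Finset.prod_nonneg fun i _ => (hf _ _ (hne τ i)).1) hε
      _ = M ^ (k - 1) * ε := by
          rw [Finset.prod_const, Finset.card_erase_of_mem (Finset.mem_univ j), Finset.card_univ,
            Fintype.card_fin, mul_comm]
  -- SUM over the `(2k)!` orderings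
  have hsum : ∑ τ : Equiv.Perm (Fin (2 * k)),
      ∏ j : Fin k, f (z (τ (pairIdx k (j, 0)))) (z (τ (pairIdx k (j, 1))))
        ≤ (Nat.factorial (2 * k) : ℝ) * M ^ (k - 1) * ε := by
    refine (Finset.sum_le_sum fun τ _ => hprod τ).trans ?_
    rw [Finset.sum_const, Finset.card_univ, Fintype.card_perm, Fintype.card_fin, nsmul_eq_mul,
      mul_assoc]
  have hnn : 0 ≤ ∑ τ : Equiv.Perm (Fin (2 * k)),
      ∏ j : Fin k, f (z (τ (pairIdx k (j, 0)))) (z (τ (pairIdx k (j, 1)))) :=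
    Finset.sum_nonneg fun τ _ => Finset.prod_nonneg fun i _ => (hf _ _ (hne τ i)).1
  -- the normalisation `(2ᵏ k!)⁻¹ ≤ 1`
  have hc : ((2 : ℝ) ^ k * (Nat.factorial k : ℝ))⁻¹ ≤ 1 :=
    inv_le_one_of_one_le₀ (one_le_mul_of_one_le_of_one_le (one_le_pow₀ one_le_two)
      (by exact_mod_cast Nat.succ_le_of_lt (Nat.factorial_pos k)))
  unfold pairingSum
  calc _ ≤ 1 * ∑ τ : Equiv.Perm (Fin (2 * k)),
        ∏ j : Fin k, f (z (τ (pairIdx k (j, 0)))) (z (τ (pairIdx k (j, 1)))) :=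
        mul_le_mul_of_nonneg_right hc hnn
    _ ≤ _ := by rw [one_mul]; exact hsum

end Summit.CriticalPhenomena.Ising3DConformalLimit.Cruxes.InversionUpgradeNormalised.FreeEndpointGaussianClosure

end
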